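import Literature.AlgebraicGeometry.Frobenioids.GeometricFrobenioidModel
import HarnessLib

/-!
# Frobenioids I, Theorem 6.2 (i) at the Frobenius morphism: "`ψ` satisfies the conditions of (i), hence
# determines a functor `Ψ : C → C`" — PROOF (instance of the schema `Thm62i`)

Mochizuki, *The geometry of Frobenioids I: the general theory*, Kyushu J. Math. **62** (2008) 293–400,
Theorem 6.2 (ii), kurims text p. 110 l. 33 – p. 111 l. 2: "If `K` is of positive characteristic `p`, then the
Frobenius morphism `ψ : V → V` satisfies the conditions of (i) [for `D_{K₁} = D_{K₂} = D_K`, `K̃₁ = K̃₂ = K̃`];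
denote the resulting functor `C → C` by `Ψ`"; (i), p. 110: "`ψ` induces a functor `Ψ : C₁ → C₂` [well-defined up to
isomorphism] that is compatible with Frobenius degrees, the functor `D₁ → D₂` induced by `K₁ ↪ K₂`, and the natural
transformations `Φ₁ → Φ₂|_{D₁}`". [cite: MochizukiFrdI2008, Thm. 6.2 (ii) p.110]

PROOF-ONLY (seat abc-iut-L6-t10). abc-iut-L1-t3's `Thm62i M M₂ βψ φψ` is a SCHEMA over the (i)-data `βψ`, `φψ`
(faithful only at THE data induced by a dominant `ψ`). The ONE such datum the interface carries is the Frobenius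
morphism's (t3 v2: `GeometricDivisorData.frobeniusPhi p` = "`D ↦ p · D`", base functor the identity). PROVED here (no
definitions): `Thm62i_frobenius_holds` — `Thm62i (geomModelFrobenioid Γ) (geomModelFrobenioid Γ) (𝟭 D) (frobeniusPhi p)` holds,
WITNESSED by the computed functor `Ψ := frobeniusPullbackFunctor Γ p` of `GeometricFrobenioidModel.lean` (identity
on `D`, `deg_Fr` preserved, `Div(Ψ φ) = p · Div(φ)`). Together with `Thm62ii_holds` (its isomorphism with the naive
Frobenius functor) this is Thm. 6.2 (ii) in full for the constructed `C_{K̃/K}` (the Frobenioid premise `hF` of the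
latter being discharged modulo saturation in `GeometricFrobenioidNonDilating.lean`).
No definitions; nothing here bears on [IUTchIII] or asserts anything about abc.
-/

noncomputable section

namespace Literature.AlgebraicGeometry.Frobenioids

open CategoryTheory Opposite

variable {K : Type} [Field K] {Kt : Type} [Field Kt] [Algebra K Kt] [IsGalois K Kt]
  (Γ : GeometricDivisorData K Kt)

/-- **Theorem 6.2 (i) for the Frobenius morphism** ((ii), FrdI p. 110 l. 33 – p. 111 l. 2: "the Frobenius morphism
`ψ : V → V` satisfies the conditions of (i) …; denote the resulting functor `C → C` by `Ψ`") — abc-iut-L1-t3's schema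
`Thm62i` PROVED at the Frobenius data of the CONSTRUCTED model `C_{K̃/K}`: base functor `𝟭 D`, divisor maps
`frobeniusPhi p : D ↦ p · D`; the witness is `Ψ := frobeniusPullbackFunctor Γ p` — over the identity of `D`,
preserving Frobenius degrees, with `Div(Ψ φ) = p · Div(φ)`. [cite: MochizukiFrdI2008, Thm. 6.2 (i) p.110] -/
theorem Thm62i_frobenius_holds (p : ℕ+) :
    Thm62i (geomModelFrobenioid Γ) (geomModelFrobenioid Γ) (𝟭 (FinSubextCat K Kt))
      (fun X => Γ.frobeniusPhi p X) := by
  -- `Ψ` lies over the identity of `D` (it does not change `Spec L`): the comparison `η` is the identity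
  refine ⟨frobeniusPullbackFunctor Γ p,
    NatIso.ofComponents (fun _ => Iso.refl _) (fun _ => by erw [Category.comp_id]),
    fun A B f => rfl, fun A B f => ?_⟩
  change ModelFrobenioid.div ((frobeniusPullbackFunctor Γ p).map f) =
    (geomFrobenioidOps Γ).pull (𝟙 A.base) (Γ.frobeniusPhi p A.base (ModelFrobenioid.div f))
  rw [(geomFrobenioidOps Γ).pull_id]
  rfl

end Literature.AlgebraicGeometry.Frobenioids

end
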